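import Summits.ResolutionOfSingularities.ResolutionOfSingularities.Theorems.HomologicalConductorNoZenoBeta1Trdeg3
import Summits.ResolutionOfSingularities.ResolutionOfSingularities.Theorems.HomologicalConductorNoZenoE3CoarseningSplit
import Literature.AlgebraicGeometry.Resolution.TranscendenceDefect
import HarnessLib

/-!
# Crux `NoZenoR` (stmt-ResolutionOfSingularities-19943): THE tr.deg ≥ 4 BLOCK — every frontier half of the registry follows BY NAME from ONE text
# `KernelHigh` («a kernel datum of transcendence degree ≥ 4 terminates»)

OURS (cell res-hironaka, crux chain W4.4; lead res-L0-w44-lead-1 g10, DESK WORD 45 (2) — the by-name reductions behind the V34 MERGE RECIPE r1,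
HOME `L/res-L0-w44-lead-1/V34-MERGE-RECIPE-r1.md`).  AI-written, weaker than expert review; nothing here is a statement of the manuscript under
review (Hironaka 2017).  SUPPORT-level, counted 0.  Def-free, fact-free.  The tr.deg ≥ 4 halves are FRONTIER-ADJACENT (no local uniformization in
dimension ≥ 4 in positive characteristic); this file does not attack them, it only shows that ONE text carries all four registry slots/halves:

* `exhHigh_of_kernelHigh : <KernelHigh> → <ExhHigh>` (binder `a` of `Beta1Trdeg3.beta1RankOneSharpF_of_split`),
* `capHigh_of_kernelHigh : <KernelHigh> → <CapHigh>` (binder `c`; capture by the stationary regular stage, `NoetherianCapture.capture_of_isRegularLocalRing_tower`),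
* `h_of_kernelHigh : <KernelHigh> → <H>` (binder `h4` of `CompositeSplit.noCaZenoChainSharp_of_split`; no chain after a regular stage),
* `threadHigh_of_kernelHigh : <KernelHigh> → <slot-4 text>` (`Beta2Descent.Sig.stub_kernelNoZenoThreadHigh` of the registry, written out: a
  terminating tower has no singular prime thread, `noThread_of_terminates`),
* `kernelHigh_of_defectSplit : <KernelHigh^{Abh}> → <KernelHigh^{def}> → <KernelHigh>` — the Abhyankar foothold (δ = 0: fact-free interlacing and
  exceptional equations in every dimension, `…NoZenoInterlacingAbhyankar` p589223) split off by name.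

`KernelHigh` := the common kernel block (`hk hA hfr hAO`, `hker`, `hmax`, `IH`, `hzd`) + `4 ≤ Algebra.trdeg k K` ⊢ `∃ m, IsRegularLocalRing (tower O A m)`.
-/

noncomputable section

-- single-problem summit: the doubled namespace component `ResolutionOfSingularities` is forced
set_option linter.dupNamespace false

namespace Summit.ResolutionOfSingularities.ResolutionOfSingularities.Theorems.NoZeno.KernelHigh

open Summit.ResolutionOfSingularities.ResolutionOfSingularities.Theses.HomologicalConductor
open Summit.ResolutionOfSingularities.ResolutionOfSingularities.Theorems.NoZeno.Birth
open Summit.ResolutionOfSingularities.ResolutionOfSingularities.Theorems.NoZeno.SandwichCluster.Parasite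
open Summit.ResolutionOfSingularities.ResolutionOfSingularities.Theorems
open Summit.ResolutionOfSingularities.ResolutionOfSingularities.Theorems.NoZeno
open Literature.AlgebraicGeometry.Resolution IsLocalRing

variable {k K : Type} [Field k] [Field K] [Algebra k K]

/-! ## A terminating tower has no singular prime thread -/

/-- A regular stage has `1 ∈ ca` (`ca = ⊤` for a regular local ring: tree `cohomologyAnnihilator_eq_top_iff_isRegularLocalRing`).
[cite: IyengarTakahashi2014, Thm. 5.4] -/
theorem one_mem_ca_of_isRegularLocalRing (B : Subalgebra k K) (hreg : IsRegularLocalRing ↥B) : (1 : K) ∈ ca B := by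
  have htop := (Literature.RingTheory.CohomologyAnnihilator.cohomologyAnnihilator_eq_top_iff_isRegularLocalRing (R := ↥B)).mpr hreg
  have h1' : ((1 : ↥B) : K) ∈ ca B := (tn_coe_mem_ca_iff B 1).mpr (by rw [htop]; trivial)
  simpa using h1'

/-- **A singular prime thread is immortal**: no stage of a threaded tower is regular (`1 ∈ ca(T_m) ⊆ 𝔭_m`). [OURS: idea-1 Sketch r7; registry v23] -/
theorem not_isRegularLocalRing_of_singularPrimeThread (O : ValuationSubring K) (A : Subalgebra k K) (h : SingularPrimeThread O A) :
    ∀ m : ℕ, ¬ IsRegularLocalRing ↥(tower O A m) := by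
  intro m hreg
  obtain ⟨P, hP, -, hca, -, -⟩ := h
  have h1 : (⟨(1 : K), (tower O A m).one_mem⟩ : ↥(tower O A m)) ∈ P m :=
    hca m 1 (tower O A m).one_mem (one_mem_ca_of_isRegularLocalRing _ hreg)
  have e : (⟨(1 : K), (tower O A m).one_mem⟩ : ↥(tower O A m)) = 1 := rfl
  rw [e] at h1
  exact (hP m).ne_top ((Ideal.eq_top_iff_one _).mpr h1)

/-- **Termination forbids singular prime threads.** [OURS: registry v23] -/
theorem noThread_of_terminates (O : ValuationSubring K) (A : Subalgebra k K)
    (hterm : ∃ m : ℕ, IsRegularLocalRing ↥(tower O A m)) : ¬ SingularPrimeThread O A :=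
  fun h => by obtain ⟨m, hm⟩ := hterm; exact not_isRegularLocalRing_of_singularPrimeThread O A h m hm

/-! ## The four frontier halves from `KernelHigh` -/

/-- **ExhHigh from KernelHigh** (the rank-one / exhaustion / thread binders are simply not used). [this work; composition] -/
theorem exhHigh_of_kernelHigh
    (hHigh :
      PersistenceRadical → StrictDrop → ∀ p : ℕ, p.Prime → ∀ (k K : Type) [Field k] [CharP k p] [Field K]
        [Algebra k K] (O : ValuationSubring K) (A : Subalgebra k K), (∀ c : k, algebraMap k K c ∈ O) →
        A.FG → IsFractionRing ↥A K → A.toSubring ≤ O.toSubring →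
        (∀ O' : ValuationSubring K,
          (∀ m : ℕ, ∀ s ∈ tower O A m, s ∈ O' ∧ (s⁻¹ ∈ O' → s⁻¹ ∈ O)) → ¬ IsNoetherianRing ↥O') →
        (∀ O' : ValuationSubring K, O < O' → ∃ m : ℕ, ∃ s ∈ tower O A m, s⁻¹ ∈ O' ∧ s⁻¹ ∉ O) →
        (∀ (k' K' : Type) [Field k'] [CharP k' p] [Field K'] [Algebra k' K'] (O' : ValuationSubring K')
          (A' : Subalgebra k' K'), (∀ c : k', algebraMap k' K' c ∈ O') → A'.FG → IsFractionRing ↥A' K' →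
          A'.toSubring ≤ O'.toSubring → Algebra.trdeg k' K' < Algebra.trdeg k K →
          ∃ m : ℕ, IsRegularLocalRing ↥(tower O' A' m)) →
        (∀ m : ℕ, ∀ s ∈ tower O A m, ∃ f : Polynomial k, f ≠ 0 ∧ O.valuation (Polynomial.aeval s f) < 1) →
        4 ≤ Algebra.trdeg k K →
        ∃ m : ℕ, IsRegularLocalRing ↥(tower O A m)) :
    PersistenceRadical → StrictDrop → ∀ p : ℕ, p.Prime → ∀ (k K : Type) [Field k] [CharP k p] [Field K]
      [Algebra k K] (O : ValuationSubring K) (A : Subalgebra k K), (∀ c : k, algebraMap k K c ∈ O) →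
      A.FG → IsFractionRing ↥A K → A.toSubring ≤ O.toSubring →
      (∀ O' : ValuationSubring K,
        (∀ m : ℕ, ∀ s ∈ tower O A m, s ∈ O' ∧ (s⁻¹ ∈ O' → s⁻¹ ∈ O)) → ¬ IsNoetherianRing ↥O') →
      (∀ O' : ValuationSubring K, O < O' → ∃ m : ℕ, ∃ s ∈ tower O A m, s⁻¹ ∈ O' ∧ s⁻¹ ∉ O) →
      (∀ (k' K' : Type) [Field k'] [CharP k' p] [Field K'] [Algebra k' K'] (O' : ValuationSubring K')
        (A' : Subalgebra k' K'), (∀ c : k', algebraMap k' K' c ∈ O') → A'.FG → IsFractionRing ↥A' K' →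
        A'.toSubring ≤ O'.toSubring → Algebra.trdeg k' K' < Algebra.trdeg k K →
        ∃ m : ℕ, IsRegularLocalRing ↥(tower O' A' m)) →
      (∀ m : ℕ, ∀ s ∈ tower O A m, ∃ f : Polynomial k, f ≠ 0 ∧ O.valuation (Polynomial.aeval s f) < 1) →
      4 ≤ Algebra.trdeg k K →
      (∀ O₁ : ValuationSubring K, O < O₁ → O₁ = ⊤) →
      (∀ x : K, x ∈ O → ∃ m : ℕ, x ∈ tower O A m) →
      ¬ SingularPrimeThread O A →
      ∃ m : ℕ, IsRegularLocalRing ↥(tower O A m) :=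
  fun hP hD p hp k K _ _ _ _ O A hk hA hfr hAO hker hmax IH hzd htr _hr1 _hexh _hthr =>
    hHigh hP hD p hp k K O A hk hA hfr hAO hker hmax IH hzd htr

/-- **CapHigh from KernelHigh**: the regular stage is a noetherian subring of `O` capturing every later conductor
(`NoetherianCapture.capture_of_isRegularLocalRing_tower`). [this work; composition] -/
theorem capHigh_of_kernelHigh
    (hHigh :
      PersistenceRadical → StrictDrop → ∀ p : ℕ, p.Prime → ∀ (k K : Type) [Field k] [CharP k p] [Field K]
        [Algebra k K] (O : ValuationSubring K) (A : Subalgebra k K), (∀ c : k, algebraMap k K c ∈ O) →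
        A.FG → IsFractionRing ↥A K → A.toSubring ≤ O.toSubring →
        (∀ O' : ValuationSubring K,
          (∀ m : ℕ, ∀ s ∈ tower O A m, s ∈ O' ∧ (s⁻¹ ∈ O' → s⁻¹ ∈ O)) → ¬ IsNoetherianRing ↥O') →
        (∀ O' : ValuationSubring K, O < O' → ∃ m : ℕ, ∃ s ∈ tower O A m, s⁻¹ ∈ O' ∧ s⁻¹ ∉ O) →
        (∀ (k' K' : Type) [Field k'] [CharP k' p] [Field K'] [Algebra k' K'] (O' : ValuationSubring K')
          (A' : Subalgebra k' K'), (∀ c : k', algebraMap k' K' c ∈ O') → A'.FG → IsFractionRing ↥A' K' →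
          A'.toSubring ≤ O'.toSubring → Algebra.trdeg k' K' < Algebra.trdeg k K →
          ∃ m : ℕ, IsRegularLocalRing ↥(tower O' A' m)) →
        (∀ m : ℕ, ∀ s ∈ tower O A m, ∃ f : Polynomial k, f ≠ 0 ∧ O.valuation (Polynomial.aeval s f) < 1) →
        4 ≤ Algebra.trdeg k K →
        ∃ m : ℕ, IsRegularLocalRing ↥(tower O A m)) :
    PersistenceRadical → StrictDrop → ∀ p : ℕ, p.Prime → ∀ (k K : Type) [Field k] [CharP k p] [Field K]
      [Algebra k K] (O : ValuationSubring K) (A : Subalgebra k K), (∀ c : k, algebraMap k K c ∈ O) →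
      A.FG → IsFractionRing ↥A K → A.toSubring ≤ O.toSubring →
      (∀ O' : ValuationSubring K,
        (∀ m : ℕ, ∀ s ∈ tower O A m, s ∈ O' ∧ (s⁻¹ ∈ O' → s⁻¹ ∈ O)) → ¬ IsNoetherianRing ↥O') →
      (∀ O' : ValuationSubring K, O < O' → ∃ m : ℕ, ∃ s ∈ tower O A m, s⁻¹ ∈ O' ∧ s⁻¹ ∉ O) →
      (∀ (k' K' : Type) [Field k'] [CharP k' p] [Field K'] [Algebra k' K'] (O' : ValuationSubring K')
        (A' : Subalgebra k' K'), (∀ c : k', algebraMap k' K' c ∈ O') → A'.FG → IsFractionRing ↥A' K' →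
        A'.toSubring ≤ O'.toSubring → Algebra.trdeg k' K' < Algebra.trdeg k K →
        ∃ m : ℕ, IsRegularLocalRing ↥(tower O' A' m)) →
      (∀ m : ℕ, ∀ s ∈ tower O A m, ∃ f : Polynomial k, f ≠ 0 ∧ O.valuation (Polynomial.aeval s f) < 1) →
      4 ≤ Algebra.trdeg k K →
      (∀ O₁ : ValuationSubring K, O < O₁ → O₁ = ⊤) →
      (∃ t : K, t ∈ O ∧ (∀ m : ℕ, t ∉ tower O A m) ∧
        ∀ f : Polynomial k, f ≠ 0 → ¬ O.valuation (Polynomial.aeval t f) < 1) →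
      ¬ SingularPrimeThread O A →
      ∃ (N : Subalgebra k K) (m₀ : ℕ), IsNoetherianRing ↥N ∧ N.toSubring ≤ O.toSubring ∧
        ∀ m : ℕ, m₀ ≤ m → ∀ x ∈ ca (tower O A m), x ∈ N := by
  intro hP hD p hp k K _ _ _ _ O A hk hA hfr hAO hker hmax IH hzd htr _hr1 _hb _hthr
  obtain ⟨m, hm⟩ := hHigh hP hD p hp k K O A hk hA hfr hAO hker hmax IH hzd htr
  obtain ⟨hN, hNO, -, hcap⟩ := NoetherianCapture.capture_of_isRegularLocalRing_tower O A hk hA hfr hAO m hm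
  exact ⟨tower O A m, m, hN, hNO, fun m' hm' x hx => hcap m' hm' x (ca_subset _ hx)⟩

/-- **H from KernelHigh**: after the regular stage there is no `ca`-Zeno chain (`CompositeSplit.noChain_of_isRegularLocalRing_tower`).
[this work; composition] -/
theorem h_of_kernelHigh
    (hHigh :
      PersistenceRadical → StrictDrop → ∀ p : ℕ, p.Prime → ∀ (k K : Type) [Field k] [CharP k p] [Field K]
        [Algebra k K] (O : ValuationSubring K) (A : Subalgebra k K), (∀ c : k, algebraMap k K c ∈ O) →
        A.FG → IsFractionRing ↥A K → A.toSubring ≤ O.toSubring →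
        (∀ O' : ValuationSubring K,
          (∀ m : ℕ, ∀ s ∈ tower O A m, s ∈ O' ∧ (s⁻¹ ∈ O' → s⁻¹ ∈ O)) → ¬ IsNoetherianRing ↥O') →
        (∀ O' : ValuationSubring K, O < O' → ∃ m : ℕ, ∃ s ∈ tower O A m, s⁻¹ ∈ O' ∧ s⁻¹ ∉ O) →
        (∀ (k' K' : Type) [Field k'] [CharP k' p] [Field K'] [Algebra k' K'] (O' : ValuationSubring K')
          (A' : Subalgebra k' K'), (∀ c : k', algebraMap k' K' c ∈ O') → A'.FG → IsFractionRing ↥A' K' →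
          A'.toSubring ≤ O'.toSubring → Algebra.trdeg k' K' < Algebra.trdeg k K →
          ∃ m : ℕ, IsRegularLocalRing ↥(tower O' A' m)) →
        (∀ m : ℕ, ∀ s ∈ tower O A m, ∃ f : Polynomial k, f ≠ 0 ∧ O.valuation (Polynomial.aeval s f) < 1) →
        4 ≤ Algebra.trdeg k K →
        ∃ m : ℕ, IsRegularLocalRing ↥(tower O A m)) :
    PersistenceRadical → StrictDrop → ∀ p : ℕ, p.Prime → ∀ (k K : Type) [Field k] [CharP k p] [Field K]
      [Algebra k K] (O : ValuationSubring K) (A : Subalgebra k K), (∀ c : k, algebraMap k K c ∈ O) →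
      A.FG → IsFractionRing ↥A K → A.toSubring ≤ O.toSubring →
      (∀ O' : ValuationSubring K,
        (∀ m : ℕ, ∀ s ∈ tower O A m, s ∈ O' ∧ (s⁻¹ ∈ O' → s⁻¹ ∈ O)) → ¬ IsNoetherianRing ↥O') →
      (∀ O' : ValuationSubring K, O < O' → ∃ m : ℕ, ∃ s ∈ tower O A m, s⁻¹ ∈ O' ∧ s⁻¹ ∉ O) →
      (∀ (k' K' : Type) [Field k'] [CharP k' p] [Field K'] [Algebra k' K'] (O' : ValuationSubring K')
        (A' : Subalgebra k' K'), (∀ c : k', algebraMap k' K' c ∈ O') → A'.FG → IsFractionRing ↥A' K' →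
        A'.toSubring ≤ O'.toSubring → Algebra.trdeg k' K' < Algebra.trdeg k K →
        ∃ m : ℕ, IsRegularLocalRing ↥(tower O' A' m)) →
      (∀ m : ℕ, ∀ s ∈ tower O A m, ∃ f : Polynomial k, f ≠ 0 ∧ O.valuation (Polynomial.aeval s f) < 1) →
      4 ≤ Algebra.trdeg k K →
      (∃ O₁ : ValuationSubring K, O < O₁ ∧ O₁ ≠ ⊤) →
      ¬ SingularPrimeThread O A →
      ∃ O₁ : ValuationSubring K, O < O₁ ∧ O₁ ≠ ⊤ ∧ ∃ m₀ : ℕ, ¬ ∃ z : ℕ → K,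
        (∀ n : ℕ, (∃ m : ℕ, m₀ ≤ m ∧ z n ∈ ca (tower O A m)) ∧ z n ≠ 0 ∧ (z n)⁻¹ ∈ O₁) ∧
        (∀ n : ℕ, z n * (z (n + 1))⁻¹ ∈ O) ∧ ∀ n : ℕ, z (n + 1) * (z n)⁻¹ ∉ O := by
  intro hP hD p hp k K _ _ _ _ O A hk hA hfr hAO hker hmax IH hzd htr hO₁ _hthr
  obtain ⟨m, hm⟩ := hHigh hP hD p hp k K O A hk hA hfr hAO hker hmax IH hzd htr
  obtain ⟨O₁, hlt, htop⟩ := hO₁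
  exact ⟨O₁, hlt, htop, m, CompositeSplit.noChain_of_isRegularLocalRing_tower O A hk hA hfr hAO m hm O₁⟩

/-- **Slot 4 (`stub_kernelNoZenoThreadHigh`, the registry's β2-high text written out) from KernelHigh**: `3 < tr.deg` is `4 ≤ tr.deg` for a
cardinal, and a terminating tower has no singular prime thread. [this work; composition] -/
theorem threadHigh_of_kernelHigh
    (hHigh :
      PersistenceRadical → StrictDrop → ∀ p : ℕ, p.Prime → ∀ (k K : Type) [Field k] [CharP k p] [Field K]
        [Algebra k K] (O : ValuationSubring K) (A : Subalgebra k K), (∀ c : k, algebraMap k K c ∈ O) →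
        A.FG → IsFractionRing ↥A K → A.toSubring ≤ O.toSubring →
        (∀ O' : ValuationSubring K,
          (∀ m : ℕ, ∀ s ∈ tower O A m, s ∈ O' ∧ (s⁻¹ ∈ O' → s⁻¹ ∈ O)) → ¬ IsNoetherianRing ↥O') →
        (∀ O' : ValuationSubring K, O < O' → ∃ m : ℕ, ∃ s ∈ tower O A m, s⁻¹ ∈ O' ∧ s⁻¹ ∉ O) →
        (∀ (k' K' : Type) [Field k'] [CharP k' p] [Field K'] [Algebra k' K'] (O' : ValuationSubring K')
          (A' : Subalgebra k' K'), (∀ c : k', algebraMap k' K' c ∈ O') → A'.FG → IsFractionRing ↥A' K' →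
          A'.toSubring ≤ O'.toSubring → Algebra.trdeg k' K' < Algebra.trdeg k K →
          ∃ m : ℕ, IsRegularLocalRing ↥(tower O' A' m)) →
        (∀ m : ℕ, ∀ s ∈ tower O A m, ∃ f : Polynomial k, f ≠ 0 ∧ O.valuation (Polynomial.aeval s f) < 1) →
        4 ≤ Algebra.trdeg k K →
        ∃ m : ℕ, IsRegularLocalRing ↥(tower O A m)) :
    PersistenceRadical → StrictDrop → ∀ p : ℕ, p.Prime → ∀ (k K : Type) [Field k] [CharP k p] [Field K]
      [Algebra k K] (O : ValuationSubring K) (A : Subalgebra k K), (∀ c : k, algebraMap k K c ∈ O) →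
      A.FG → IsFractionRing ↥A K → A.toSubring ≤ O.toSubring →
      (∀ O' : ValuationSubring K,
        (∀ m : ℕ, ∀ s ∈ tower O A m, s ∈ O' ∧ (s⁻¹ ∈ O' → s⁻¹ ∈ O)) → ¬ IsNoetherianRing ↥O') →
      (∀ O' : ValuationSubring K, O < O' → ∃ m : ℕ, ∃ s ∈ tower O A m, s⁻¹ ∈ O' ∧ s⁻¹ ∉ O) →
      (∀ (k' K' : Type) [Field k'] [CharP k' p] [Field K'] [Algebra k' K'] (O' : ValuationSubring K')
        (A' : Subalgebra k' K'), (∀ c : k', algebraMap k' K' c ∈ O') → A'.FG → IsFractionRing ↥A' K' →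
        A'.toSubring ≤ O'.toSubring → Algebra.trdeg k' K' < Algebra.trdeg k K →
        ∃ m : ℕ, IsRegularLocalRing ↥(tower O' A' m)) →
      (∀ m : ℕ, ∀ s ∈ tower O A m, ∃ f : Polynomial k, f ≠ 0 ∧ O.valuation (Polynomial.aeval s f) < 1) →
      3 < Algebra.trdeg k K →
      ¬ SingularPrimeThread O A := by
  intro hP hD p hp k K _ _ _ _ O A hk hA hfr hAO hker hmax IH hzd htr
  have key : ((3 : ℕ) : Cardinal) + 1 ≤ Algebra.trdeg k K := Cardinal.natCast_add_one_le_iff.2 (by exact_mod_cast htr)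
  have e : ((3 : ℕ) : Cardinal) + 1 = 4 := by norm_num
  rw [e] at key
  exact noThread_of_terminates O A (hHigh hP hD p hp k K O A hk hA hfr hAO hker hmax IH hzd key)

/-! ## The Abhyankar foothold -/

/-- **`KernelHigh` FROM ITS DEFECT HALVES** (`h0`: transcendence defect `0` — the Abhyankar class, where interlacing and exceptional equations are
fact-free in every dimension; `h1`: positive defect — the true frontier); the two texts are `KernelHigh` with the ground-field binder NAMED and the
defect clause inserted after the tr.deg clause. [this work; pure logic] -/
theorem kernelHigh_of_defectSplit
    (h0 :
      PersistenceRadical → StrictDrop → ∀ p : ℕ, p.Prime → ∀ (k K : Type) [Field k] [CharP k p] [Field K]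
        [Algebra k K] (O : ValuationSubring K) (A : Subalgebra k K) (hk : ∀ c : k, algebraMap k K c ∈ O),
        A.FG → IsFractionRing ↥A K → A.toSubring ≤ O.toSubring →
        (∀ O' : ValuationSubring K,
          (∀ m : ℕ, ∀ s ∈ tower O A m, s ∈ O' ∧ (s⁻¹ ∈ O' → s⁻¹ ∈ O)) → ¬ IsNoetherianRing ↥O') →
        (∀ O' : ValuationSubring K, O < O' → ∃ m : ℕ, ∃ s ∈ tower O A m, s⁻¹ ∈ O' ∧ s⁻¹ ∉ O) →
        (∀ (k' K' : Type) [Field k'] [CharP k' p] [Field K'] [Algebra k' K'] (O' : ValuationSubring K')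
          (A' : Subalgebra k' K'), (∀ c : k', algebraMap k' K' c ∈ O') → A'.FG → IsFractionRing ↥A' K' →
          A'.toSubring ≤ O'.toSubring → Algebra.trdeg k' K' < Algebra.trdeg k K →
          ∃ m : ℕ, IsRegularLocalRing ↥(tower O' A' m)) →
        (∀ m : ℕ, ∀ s ∈ tower O A m, ∃ f : Polynomial k, f ≠ 0 ∧ O.valuation (Polynomial.aeval s f) < 1) →
        4 ≤ Algebra.trdeg k K → transcendenceDefect k O hk = 0 →
        ∃ m : ℕ, IsRegularLocalRing ↥(tower O A m))
    (h1 :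
      PersistenceRadical → StrictDrop → ∀ p : ℕ, p.Prime → ∀ (k K : Type) [Field k] [CharP k p] [Field K]
        [Algebra k K] (O : ValuationSubring K) (A : Subalgebra k K) (hk : ∀ c : k, algebraMap k K c ∈ O),
        A.FG → IsFractionRing ↥A K → A.toSubring ≤ O.toSubring →
        (∀ O' : ValuationSubring K,
          (∀ m : ℕ, ∀ s ∈ tower O A m, s ∈ O' ∧ (s⁻¹ ∈ O' → s⁻¹ ∈ O)) → ¬ IsNoetherianRing ↥O') →
        (∀ O' : ValuationSubring K, O < O' → ∃ m : ℕ, ∃ s ∈ tower O A m, s⁻¹ ∈ O' ∧ s⁻¹ ∉ O) →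
        (∀ (k' K' : Type) [Field k'] [CharP k' p] [Field K'] [Algebra k' K'] (O' : ValuationSubring K')
          (A' : Subalgebra k' K'), (∀ c : k', algebraMap k' K' c ∈ O') → A'.FG → IsFractionRing ↥A' K' →
          A'.toSubring ≤ O'.toSubring → Algebra.trdeg k' K' < Algebra.trdeg k K →
          ∃ m : ℕ, IsRegularLocalRing ↥(tower O' A' m)) →
        (∀ m : ℕ, ∀ s ∈ tower O A m, ∃ f : Polynomial k, f ≠ 0 ∧ O.valuation (Polynomial.aeval s f) < 1) →
        4 ≤ Algebra.trdeg k K → transcendenceDefect k O hk ≠ 0 →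
        ∃ m : ℕ, IsRegularLocalRing ↥(tower O A m)) :
    PersistenceRadical → StrictDrop → ∀ p : ℕ, p.Prime → ∀ (k K : Type) [Field k] [CharP k p] [Field K]
      [Algebra k K] (O : ValuationSubring K) (A : Subalgebra k K), (∀ c : k, algebraMap k K c ∈ O) →
      A.FG → IsFractionRing ↥A K → A.toSubring ≤ O.toSubring →
      (∀ O' : ValuationSubring K,
        (∀ m : ℕ, ∀ s ∈ tower O A m, s ∈ O' ∧ (s⁻¹ ∈ O' → s⁻¹ ∈ O)) → ¬ IsNoetherianRing ↥O') →
      (∀ O' : ValuationSubring K, O < O' → ∃ m : ℕ, ∃ s ∈ tower O A m, s⁻¹ ∈ O' ∧ s⁻¹ ∉ O) →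
      (∀ (k' K' : Type) [Field k'] [CharP k' p] [Field K'] [Algebra k' K'] (O' : ValuationSubring K')
        (A' : Subalgebra k' K'), (∀ c : k', algebraMap k' K' c ∈ O') → A'.FG → IsFractionRing ↥A' K' →
        A'.toSubring ≤ O'.toSubring → Algebra.trdeg k' K' < Algebra.trdeg k K →
        ∃ m : ℕ, IsRegularLocalRing ↥(tower O' A' m)) →
      (∀ m : ℕ, ∀ s ∈ tower O A m, ∃ f : Polynomial k, f ≠ 0 ∧ O.valuation (Polynomial.aeval s f) < 1) →
      4 ≤ Algebra.trdeg k K →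
      ∃ m : ℕ, IsRegularLocalRing ↥(tower O A m) := by
  intro hP hD p hp k K _ _ _ _ O A hk hA hfr hAO hker hmax IH hzd htr
  by_cases hδ : transcendenceDefect k O hk = 0
  · exact h0 hP hD p hp k K O A hk hA hfr hAO hker hmax IH hzd htr hδ
  · exact h1 hP hD p hp k K O A hk hA hfr hAO hker hmax IH hzd htr hδ

end Summit.ResolutionOfSingularities.ResolutionOfSingularities.Theorems.NoZeno.KernelHigh

end
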